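import Summits.CriticalPhenomena.CardyFormulaZ2.Theorems.CardyWickAnisotropyBoxFamilyToCardyStubDomainContinuityPart3
import Summits.CriticalPhenomena.CardyFormulaZ2.Theorems.CardyBondTriangularDiscretisationBridge
import HarnessLib

/-!
# Stub `stub_domainContinuity` (S2): mesh-uniform continuity of the G02 crossing probability in
# the marked-loop topology

Crux `Summit.CriticalPhenomena.CardyFormulaZ2.Theses.CardyWickAnisotropy.BoxFamilyToCardy`
(stmt-CriticalPhenomena-14215, `AnisotropicBoxCardy → CardyFormulaZ2`), line `registered`
(`Cruxes/BoxFamilyToCardy/Lines/birth.lean`), stub `stub_domainContinuity` — registered with the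
identical name and signature on the sibling crux `ConfInvTransport` (stmt-CriticalPhenomena-0794,
`Cruxes/ConfInvTransport/Lines/birth.lean`).

**Statement.** For every conformal rectangle `R` and `τ > 0` there is `ε₀ > 0` such that every
conformal rectangle `Q` whose boundary loop is pointwise `ε₀`-close to `R.boundary` and whose mark
parameters are `ε₀`-close to `R.mark` satisfies
`|bondDomainCrossingProb Q δ - bondDomainCrossingProb R δ| ≤ τ` for all small meshes `δ`.

**Proof (cross-domain squeeze through the quads of `R`; RSW/Schramm–Smirnov technology only).**
Fix a square model `Φ` of `R` (`exists_isSquareModel`), `H = (i·) ∘ Φ`, so that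
`Q₀ = rectQuad H 1 1` is the quad of `R`. Schramm–Smirnov's Lemma 5.1, PROVED in the tree for
bond-`ℤ²` (`SchrammSmirnov2011_lemma_5_1_holds`), gives through `Quad.continuity_of_lemma_5_1`
quads `Q' < Q₀ < Q''` with `P[Q' crossed ∧ Q'' not crossed] ≤ τ` for all small meshes, and the
open-condition transfers `stub_strictlyDominated_shrink/stretch` put the wide-short quad
`W = rectQuad H (1-s₁) (1+s₁)` above `Q'` and the tall-narrow quad `T = rectQuad H (1+s₂) (1-s₂)`
below `Q''`. The two cross-domain inclusions of the helper files — UNIFORM over all `Q`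
`ε₀`-close to `R` — `discrete_subset_crossed_near` (part 1: a G02 crossing of `Q` forces
`W ∈ S_ω`) and `crossed_subset_discrete_near` (part 3: `T ∈ S_ω` forces a G02 crossing of `Q`,
through the bond port of Claim 19 with explicit plate margin, part 2) sandwich, for small `δ`,
BOTH `P_δ(Q)` and `P_δ(R)` (as `R` is `ε₀`-close to itself) in the interval
`[P(Q'' crossed), P(Q' crossed)]` of length `≤ τ` (`measureReal_sandwich`).

References: O. Schramm, S. Smirnov, *On the scaling limits of planar percolation*, Ann. Probab.
39 (2011), §1.3, Lemma 5.1 and eq. (5.1); B. Bollobás, O. Riordan, *Percolation* (2006), Ch. 7,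
Claim 19 p. 192, remark p. 195; S. Smirnov, C. R. Acad. Sci. Paris 333 (2001), §2.
-/

noncomputable section

namespace Summit.CriticalPhenomena.CardyFormulaZ2.Cruxes.BoxFamilyToCardy.Birth

open Filter Topology Set MeasureTheory Metric
open scoped ENNReal unitInterval
open Literature.Probability.Percolation hiding cardyFunction
open Literature.Probability.Percolation.QuadCrossing
open Literature.Probability.RandomPlanarGeometry hiding cardyFunction
open Literature.Probability.LatticeModels
open Summit.CriticalPhenomena.CardyFormulaZ2.Cruxes.DiscretisationBridge.Birth

/-- **Per-mesh sandwich of a G02 crossing probability between two raw quad-crossing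
probabilities.** If `Q' < W` and `T < Q''` (Schramm–Smirnov order on the quads of the plane)
and, at mesh `δ`, every lattice configuration with a G02 crossing of the conformal rectangle `D`
has `W ∈ S_ω` while `T ∈ S_ω` forces a G02 crossing of `D`, then
`P(Q'' raw-crossed) ≤ bondDomainCrossingProb D δ ≤ P(Q' raw-crossed)` (almost every
configuration opens only lattice edges, `ae_subset_edgeSet`; `W ∈ S_ω` gives a raw crossing of
`Q'` by `Quad.exists_isCrossing_of_mem_closure`, a raw crossing of `Q''` contains one of `T`).
[cite: SchrammSmirnov2011, §1.3] -/
theorem measureReal_sandwich {Q' Q'' W T : Quad (univ : Set ℂ)} (hdom₁ : Quad.StrictlyDominated Q' W)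
    (hdom₂ : Quad.StrictlyDominated T Q'') (D : ConformalRectangle) {δ : ℝ}
    (hu : ∀ ω : BondConfig (Site 2), ω ⊆ (zdGraph 2).edgeSet →
      ω ∈ discreteCrossing D.carrier δ (D.arc 0) (D.arc 2) → W ∈ z2QuadConfig univ δ ω)
    (hl : ∀ ω : BondConfig (Site 2), T ∈ z2QuadConfig univ δ ω →
      ω ∈ discreteCrossing D.carrier δ (D.arc 0) (D.arc 2)) :
    (bondPercolation (zdGraph 2) half).real {ω | ∃ K, Q''.IsCrossing K ∧ K ⊆ openEdgeUnion δ ω} ≤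
        bondDomainCrossingProb D δ ∧
      bondDomainCrossingProb D δ ≤
        (bondPercolation (zdGraph 2) half).real {ω | ∃ K, Q'.IsCrossing K ∧ K ⊆ openEdgeUnion δ ω} := by
  constructor
  · rw [bondDomainCrossingProb_eq_measureReal]
    refine measureReal_mono ?_
    rintro ω ⟨K, hK, hKO⟩
    obtain ⟨K₂, hK₂K, hK₂⟩ := hdom₂.dominated K hK
    exact hl ω (mem_z2QuadConfig_of_isCrossing hK₂ (hK₂K.trans hKO))
  · rw [bondDomainCrossingProb_eq_measureReal]
    simp only [measureReal_def]
    refine ENNReal.toReal_mono (measure_ne_top _ _) (measure_mono_ae ?_)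
    filter_upwards [ae_subset_edgeSet (zdGraph 2) half] with ω hω
    intro hωD
    have hmem' : W ∈ closure {P : Quad (univ : Set ℂ) | ∃ K, P.IsCrossing K ∧ K ⊆ openEdgeUnion δ ω} := by
      rw [← coe_z2QuadConfig]; exact hu ω hω hωD
    exact Quad.exists_isCrossing_of_mem_closure hdom₁ hmem'

/-- **Schramm–Smirnov continuity as an inequality of raw crossing probabilities**:
`P(Q' raw-crossed) ≤ P(Q'' raw-crossed) + τ` once `P[Q' raw-crossed ∧ Q'' not] ≤ τ`.
[cite: SchrammSmirnov2011, Lemma 5.1 and eq. (5.1)] -/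
theorem measureReal_le_add_of_diff_le {Q' Q'' : Quad (univ : Set ℂ)} {δ τ : ℝ} (hτ : 0 ≤ τ)
    (hcont : bondPercolation (zdGraph 2) half
      {ω | (∃ K, Q'.IsCrossing K ∧ K ⊆ openEdgeUnion δ ω) ∧
        ¬ ∃ K, Q''.IsCrossing K ∧ K ⊆ openEdgeUnion δ ω} ≤ ENNReal.ofReal τ) :
    (bondPercolation (zdGraph 2) half).real {ω | ∃ K, Q'.IsCrossing K ∧ K ⊆ openEdgeUnion δ ω} ≤
      (bondPercolation (zdGraph 2) half).real {ω | ∃ K, Q''.IsCrossing K ∧ K ⊆ openEdgeUnion δ ω} +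
        τ := by
  have hdiff : (bondPercolation (zdGraph 2) half).real
      ({ω | ∃ K, Q'.IsCrossing K ∧ K ⊆ openEdgeUnion δ ω} \
        {ω | ∃ K, Q''.IsCrossing K ∧ K ⊆ openEdgeUnion δ ω}) ≤ τ := by
    rw [measureReal_def]
    exact ENNReal.toReal_le_of_le_ofReal hτ hcont
  calc (bondPercolation (zdGraph 2) half).real
        {ω | ∃ K, Q'.IsCrossing K ∧ K ⊆ openEdgeUnion δ ω}
      ≤ (bondPercolation (zdGraph 2) half).real
          ({ω | ∃ K, Q''.IsCrossing K ∧ K ⊆ openEdgeUnion δ ω} ∪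
            ({ω | ∃ K, Q'.IsCrossing K ∧ K ⊆ openEdgeUnion δ ω} \
              {ω | ∃ K, Q''.IsCrossing K ∧ K ⊆ openEdgeUnion δ ω})) :=
        measureReal_mono (fun ω hω => by
          by_cases hω'' : ω ∈ {ω | ∃ K, Q''.IsCrossing K ∧ K ⊆ openEdgeUnion δ ω}
          · exact Or.inl hω''
          · exact Or.inr ⟨hω, hω''⟩)
    _ ≤ (bondPercolation (zdGraph 2) half).real
          {ω | ∃ K, Q''.IsCrossing K ∧ K ⊆ openEdgeUnion δ ω} +
        (bondPercolation (zdGraph 2) half).real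
          ({ω | ∃ K, Q'.IsCrossing K ∧ K ⊆ openEdgeUnion δ ω} \
            {ω | ∃ K, Q''.IsCrossing K ∧ K ⊆ openEdgeUnion δ ω}) := measureReal_union_le _ _
    _ ≤ _ := by linarith

/-- **Stub S2 `stub_domainContinuity` (a-priori estimate, RSW technology, no conformal input),
proved** — verbatim the stub registered on stmt-CriticalPhenomena-14215 and on
stmt-CriticalPhenomena-0794. For every conformal rectangle `R` and `τ > 0` there is `ε₀ > 0` such
that every conformal rectangle `Q` with boundary loop pointwise `ε₀`-close to `R.boundary` (as
parametrised loops) and mark parameters `ε₀`-close to `R.mark` has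
`|bondDomainCrossingProb Q δ - bondDomainCrossingProb R δ| ≤ τ` for all sufficiently small meshes
`δ` (how small may depend on `Q`). Proof: the cross-domain squeeze of the module docstring —
Schramm–Smirnov's Lemma 5.1 continuity at the quad of `R` (`Quad.continuity_of_lemma_5_1`,
`SchrammSmirnov2011_lemma_5_1_holds`), the domination transfers
`stub_strictlyDominated_shrink/stretch`, and the uniform cross-domain inclusions
`discrete_subset_crossed_near`, `crossed_subset_discrete_near`, assembled by
`measureReal_sandwich` for `Q` and for `R`. [cite: SchrammSmirnov2011, Lemma 5.1 and eq. (5.1)]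
[cite: BollobasRiordan2006, Ch. 7 Claim 19 p. 192 and remark p. 195] -/
theorem stub_domainContinuity :
    ∀ R : Literature.Probability.RandomPlanarGeometry.ConformalRectangle, ∀ τ : ℝ, 0 < τ → ∃ ε₀ : ℝ, 0 < ε₀ ∧ ∀ Q : Literature.Probability.RandomPlanarGeometry.ConformalRectangle, (∀ u : ℝ, dist (Q.boundary u) (R.boundary u) ≤ ε₀) → (∀ i : Fin 4, |Q.mark i - R.mark i| ≤ ε₀) → ∀ᶠ δ in nhdsWithin (0 : ℝ) (Set.Ioi 0), |Literature.Probability.Percolation.bondDomainCrossingProb Q δ - Literature.Probability.Percolation.bondDomainCrossingProb R δ| ≤ τ := by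
  intro R τ hτ
  -- the square model of `R`, its quad, and Schramm–Smirnov's Lemma 5.1 continuity at precision `τ`
  obtain ⟨Φ, hΦ⟩ := exists_isSquareModel R
  obtain ⟨Q', Q'', h', h'', δ₁, hδ₁, hcont⟩ :=
    Quad.continuity_of_lemma_5_1 SchrammSmirnov2011_lemma_5_1_holds
      (Quad.rectQuad ((Homeomorph.mulLeft₀ Complex.I Complex.I_ne_zero).trans Φ) 1 1 one_pos
        one_pos (fun _ => mem_univ _)) (ENNReal.ofReal τ) (ENNReal.ofReal_pos.2 hτ)
  -- the wide-short quad `W = Q_{1-s₁,1+s₁} > Q'` and the tall-narrow quad `T = Q_{1+s₂,1-s₂} < Q''`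
  obtain ⟨s₁, hs₁, hs₁1, hs₁h, hdom₁⟩ :=
    stub_strictlyDominated_shrink ((Homeomorph.mulLeft₀ Complex.I Complex.I_ne_zero).trans Φ) Q' h'
  obtain ⟨s₂, hs₂, hs₂1, -, hdom₂⟩ :=
    stub_strictlyDominated_stretch ((Homeomorph.mulLeft₀ Complex.I Complex.I_ne_zero).trans Φ) Q'' h''
  -- the two cross-domain inclusions, uniform over the conformal rectangles close to `R`
  obtain ⟨εu, hεu, δ₂, hδ₂, hup⟩ := discrete_subset_crossed_near R Φ hΦ s₁ hs₁ hs₁h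
  obtain ⟨εl, hεl, hlow⟩ := crossed_subset_discrete_near R Φ hΦ s₂ hs₂ hs₂1
  refine ⟨min εu εl, lt_min hεu hεl, fun Q hb hm => ?_⟩
  -- `Q` and `R` itself are close to `R` at both scales
  have hbQu : ∀ u : ℝ, dist (Q.boundary u) (R.boundary u) ≤ εu :=
    fun u => (hb u).trans (min_le_left _ _)
  have hmQu : ∀ i : Fin 4, |Q.mark i - R.mark i| ≤ εu := fun i => (hm i).trans (min_le_left _ _)
  have hbQl : ∀ u : ℝ, dist (Q.boundary u) (R.boundary u) ≤ εl :=
    fun u => (hb u).trans (min_le_right _ _)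
  have hmQl : ∀ i : Fin 4, |Q.mark i - R.mark i| ≤ εl := fun i => (hm i).trans (min_le_right _ _)
  have hbRu : ∀ u : ℝ, dist (R.boundary u) (R.boundary u) ≤ εu :=
    fun u => by rw [dist_self]; exact hεu.le
  have hmRu : ∀ i : Fin 4, |R.mark i - R.mark i| ≤ εu :=
    fun i => by rw [sub_self, abs_zero]; exact hεu.le
  have hbRl : ∀ u : ℝ, dist (R.boundary u) (R.boundary u) ≤ εl :=
    fun u => by rw [dist_self]; exact hεl.le
  have hmRl : ∀ i : Fin 4, |R.mark i - R.mark i| ≤ εl :=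
    fun i => by rw [sub_self, abs_zero]; exact hεl.le
  obtain ⟨δQ, hδQ, hlowQ⟩ := hlow Q hbQl hmQl
  obtain ⟨δR, hδR, hlowR⟩ := hlow R hbRl hmRl
  -- small meshes
  have hS : ∀ᶠ δ in 𝓝[>] (0 : ℝ), δ < min (min δ₁ δ₂) (min δQ δR) :=
    mem_nhdsWithin_of_mem_nhds (Iio_mem_nhds (lt_min (lt_min hδ₁ hδ₂) (lt_min hδQ hδR)))
  filter_upwards [hS, self_mem_nhdsWithin] with δ hSδ hδ
  have hδ0 : (0 : ℝ) < δ := hδ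
  have hδ₁' : δ < δ₁ := hSδ.trans_le ((min_le_left _ _).trans (min_le_left _ _))
  have hδ₂' : δ < δ₂ := hSδ.trans_le ((min_le_left _ _).trans (min_le_right _ _))
  have hδQ' : δ < δQ := hSδ.trans_le ((min_le_right _ _).trans (min_le_left _ _))
  have hδR' : δ < δR := hSδ.trans_le ((min_le_right _ _).trans (min_le_right _ _))
  -- Schramm–Smirnov: `P(Q' crossed) ≤ P(Q'' crossed) + τ`
  have hSS := measureReal_le_add_of_diff_le hτ.le (hcont δ hδ0 hδ₁')
  -- the sandwich for `Q` and for `R`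
  obtain ⟨hQ1, hQ2⟩ := measureReal_sandwich hdom₁ hdom₂ Q
    (fun ω hω hωD => hup Q hbQu hmQu δ hδ0 hδ₂' ω hω hωD) (fun ω hT => hlowQ δ hδ0 hδQ' ω hT)
  obtain ⟨hR1, hR2⟩ := measureReal_sandwich hdom₁ hdom₂ R
    (fun ω hω hωD => hup R hbRu hmRu δ hδ0 hδ₂' ω hω hωD) (fun ω hT => hlowR δ hδ0 hδR' ω hT)
  rw [abs_le]
  constructor
  · linarith
  · linarith

end Summit.CriticalPhenomena.CardyFormulaZ2.Cruxes.BoxFamilyToCardy.Birth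

end
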